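import Summits.Ventures.QEDPrecision.Diagrams.LeptonLoopGraphsOrder10High
import Summits.Ventures.QEDPrecision.Diagrams.LeptonLoopGraphsOrder10Low

/-!
HONEST FRAMING: independent recomputation; certified where stated, statistical where stated; no new-physics claim.
Venture QEDPrecision / cell `pub-qed`, unit `pub-qed-diag-2` (DIAG-2, gen 3); NEW WORK of the cell (kernel-checked census), not a
published result.  Model, definitions and counting conventions: `LeptonLoopGraphs.lean` (Python mirror tools/loops_model.py of the
unit folder; staged copies under HOME/lean/diag2/, HOME = run/shared/lean/pub/pub-qed/).

# Order e¹⁰ census of QED vertex graphs with lepton loops — the structure table and the totals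

Assembled from the 19 per-structure rows of `LeptonLoopGraphsOrder10High.lean` / `…Low.lean` by rewriting (no further enumeration):
`structureTable 5` explicitly, the column sums 12672 directed / 5536 undirected, and two cross-checks on the numerals against
`NoLoopVertexGraphs` (the loop-free row is `order10_values`; the one-vacuum-polarisation row (9,[2]) has `4 · 518` directed graphs).
Printed comparators (named only here, in a comment): 12672 = AHKN's number of tenth-order vertex diagrams (Kinoshita–Nio
hep-ph/0512330 p.7; Aoyama–Hayakawa–Kinoshita–Nio arXiv:1205.5368), of which 6354 without lepton loops (Set V) and 2072 in Set IV;
5536 = the sum of `N_graph` over the 95 classes of Volkov arXiv:2404.00649 Table I (the cell's transcription, checked 95/95 against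
its generator in HOME/pub-qed-diag-2/COUNTS.md §3), of which 3213 without lepton loops (arXiv:1909.08015 p.9).
-/

namespace Summit.Ventures.QEDPrecision.Diagrams

/-- order e¹⁰ structure table (19 structures; the 7 with `p = 1` are empty), assembled from the rows. -/
theorem order10_table :
    structureTable 5 = [(11, [], 6354, 3213), (9, [2], 2072, 1049), (7, [4], 1332, 387), (7, [2, 2], 300, 158),
      (5, [6], 960, 265), (5, [4, 2], 408, 120), (5, [2, 2, 2], 24, 14), (3, [8], 735, 201), (3, [6, 2], 300, 82),
      (3, [4, 4], 132, 28), (3, [4, 2, 2], 54, 18), (3, [2, 2, 2, 2], 1, 1), (1, [10], 0, 0), (1, [8, 2], 0, 0),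
      (1, [6, 4], 0, 0), (1, [6, 2, 2], 0, 0), (1, [4, 4, 2], 0, 0), (1, [4, 2, 2, 2], 0, 0), (1, [2, 2, 2, 2, 2], 0, 0)] := by
  have hs := structures_values.2.2.2
  simp only [structureTable, hs, List.map_cons, List.map_nil, order10_row_11_noloops, order10_row_9_2, order10_row_7_4,
    order10_row_7_2_2, order10_row_5_6, order10_row_5_4_2, order10_row_5_2_2_2, order10_row_3_8, order10_row_3_6_2,
    order10_row_3_4_4, order10_row_3_4_2_2, order10_row_3_2_2_2_2, order10_row_1_10, order10_row_1_8_2, order10_row_1_6_4,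
    order10_row_1_6_2_2, order10_row_1_4_4_2, order10_row_1_4_2_2_2, order10_row_1_2_2_2_2_2]

/-- order e¹⁰ totals: 12672 directed (AHKN, hep-ph/0512330 p.7; arXiv:1205.5368) / 5536 undirected (= the sum of N_graph over the
95 classes of Volkov arXiv:2404.00649 Table I), from the table. -/
theorem order10_totals : tableTotals (structureTable 5) = (12672, 5536) := by
  rw [order10_table]; decide

/-- order e¹⁰ cross-checks on the numerals: the loop-free row is `order10_values` of `NoLoopVertexGraphs` (6354 / 3213), and the
single-vacuum-polarisation row (9,[2]) is `4 × 518` directed (one second-order lepton loop on one of the 4 photons of an order-e⁸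
loop-free vertex graph; AHKN's Set IV count 2072). -/
theorem order10_crosschecks :
    countRow 5 11 [] = (vertexDirected 5, vertexUndirected 5) ∧ (countRow 5 9 [2]).1 = 4 * vertexDirected 4 := by
  obtain ⟨a5, b5, -⟩ := order10_values
  obtain ⟨-, -, -, a4⟩ := vertexDirected_values
  rw [a5, b5, a4, order10_row_11_noloops, order10_row_9_2]
  decide

end Summit.Ventures.QEDPrecision.Diagrams
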